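import Literature.Probability.RandomPlanarGeometry.SLEThrStrictClock
import Mathlib.MeasureTheory.Constructions.Polish.StronglyMeasurable
import HarnessLib

/-!
# The strongly progressive modification `Ỹ` of the stopped through-swallow driving process of SLE₆

Sequel of `SLEThroughSwallowMartingale` / `SLEThrStrictClock` (Lawler–Schramm–Werner (2001) Thm. 2.2 /
G. F. Lawler (2005) §6.3 Thm. 6.13). Under the hypotheses delivered by the horizon `thrHorizon`
(`SLEThrHorizonProofs`): the cluster dichotomy at all `t < H` on EVERY path (`hclw_lt`) and at all `t ≤ H`
on ALMOST EVERY path (`hclw_ae`), the raw process `Y_t = (√6)⁻¹ U*_{t ∧ H}` takes a junk value at `t ≥ H`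
on the null set of paths where a cluster is first touched exactly at `H`; its modification

* `thrYMod hA hδ H t ω = (√6)⁻¹ · limUnder_n (thrLevelSum 6 hA hδ H n t ω)` (definition)

is the process fed to the Dambis–Dubins–Schwarz packaging:
(1) `hasMartingaleClock_thrYMod` — `Ỹ` carries the through-swallow clock `c_t = σ_A(t ∧ H)`
(`Process.HasMartingaleClock`; the clock fields hold on every path by `SLEThrStrictClock`);
(2) `isStronglyProgressive_thrYMod` — `Ỹ` is strongly progressive on every path (`StronglyMeasurable.limUnder`);
(3) `adapted_thrClockProc_of_lt` — `c` is adapted (every path); (4) `ae_continuous_thrYMod` — continuous paths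
a.s.; (5) `ae_thrYMod_eq` — `Ỹ = Y` on almost every path; (6) `thrYMod_zero` — `Ỹ_0 = 0` on every path;
`integrableOn_thrClockRate_untopD_of_lt` — the clock rate is integrable up to the horizon on every path; and
`hasMartingaleClock_thrImageDriver_of_ae` — the martingale clock structure of the raw `Y` under the weakened
hypotheses (`HasMartingaleClock.congr_ae`).

## References

* G. F. Lawler, O. Schramm, W. Werner, Acta Math. **187** (2001), Thm. 2.2. [LawlerSchrammWerner2001]
* G. F. Lawler (2005), §6.3 Thm. 6.13. [Lawler2005]
* D. Revuz, M. Yor (1999), Ch. V (1.6). [RevuzYor1999]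
-/

noncomputable section

open Set Filter Metric Function MeasureTheory
open _root_.Complex _root_.Topology
open scoped NNReal

namespace Literature.Probability.RandomPlanarGeometry

open Loewner Literature.Probability.Process

variable {κ : ℝ≥0} {A : Set ℂ} {hA : IsStarHull A} {δ : ℝ} {hδ : 0 < δ} {H : (ℝ≥0 → ℝ) → WithTop ℝ≥0}

/-! ### The strongly progressive modification `Ỹ` of the stopped through-swallow driving process -/

section Modification

/-- **The modification `Ỹ_t = (√6)⁻¹ · lim_n U^n_t`** of the process `Y_t = (√6)⁻¹ U*_{t ∧ H}`: the limit
(Mathlib `limUnder`, junk where the level-`n` sums do not converge) of the level-`n` approximations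
`thrLevelSum`. It is strongly progressive on every path and agrees with `Y` on every path along which the
cluster dichotomy holds up to and including the horizon (almost every path). [folklore] -/
def thrYMod (hA : IsStarHull A) (hδ : 0 < δ) (H : (ℝ≥0 → ℝ) → WithTop ℝ≥0) (t : ℝ≥0) (ω : ℝ≥0 → ℝ) : ℝ :=
  (Real.sqrt 6)⁻¹ * limUnder atTop fun n ↦ thrLevelSum 6 hA hδ H n t ω

variable {N : ℕ} {T₀ : ℝ≥0}

/-- Unfolding of `thrYMod`. [folklore] -/
theorem thrYMod_def (hA : IsStarHull A) (hδ : 0 < δ) (H : (ℝ≥0 → ℝ) → WithTop ℝ≥0) (t : ℝ≥0) (ω : ℝ≥0 → ℝ) :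
    thrYMod hA hδ H t ω = (Real.sqrt 6)⁻¹ * limUnder atTop fun n ↦ thrLevelSum 6 hA hδ H n t ω := rfl

/-- **(6) `Ỹ_0 = 0` on every path.** [folklore] -/
theorem thrYMod_zero (hA : IsStarHull A) (hδ : 0 < δ) (H : (ℝ≥0 → ℝ) → WithTop ℝ≥0) (ω : ℝ≥0 → ℝ) :
    thrYMod hA hδ H 0 ω = 0 := by
  have h0 : ∀ n, thrLevelSum 6 hA hδ H n 0 ω = 0 := fun n ↦ by
    rw [thrLevelSum]
    refine Finset.sum_eq_zero fun s _ ↦ ?_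
    have h1 : ((0 : ℝ≥0) : WithTop ℝ≥0) ≤ thrRho 6 hA hδ H s ω := bot_le
    have h2 : ((0 : ℝ≥0) : WithTop ℝ≥0) ≤ thrSigma 6 hA hδ H s ω := bot_le
    simp only [pieceIncr, stoppedProcess_eq_of_le h1, stoppedProcess_eq_of_le h2, sub_self]
  rw [thrYMod_def]
  simp only [h0, tendsto_const_nhds.limUnder_eq, mul_zero]

/-- The level-`n` sums are strongly progressive. [folklore] -/
theorem isStronglyProgressive_thrLevelSum (hH : IsStoppingTime brownianFiltration H) (n : ℕ) :
    IsStronglyProgressive brownianFiltration (thrLevelSum κ hA hδ H n) := by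
  intro i
  simp only [thrLevelSum]
  refine Finset.stronglyMeasurable_fun_sum _ fun s hs ↦ ?_
  have hs' := Finset.mem_powerset.1 hs
  have hprog := isStronglyProgressive_pieceMart (κ := κ) hs' n
  exact ((hprog.stoppedProcess (isStoppingTime_thrSigma hH s)) i).sub ((hprog.stoppedProcess (isStoppingTime_thrRho hH hs')) i)

/-- **(2) `Ỹ` is strongly progressive** (on every path). [folklore] -/
theorem isStronglyProgressive_thrYMod (hA : IsStarHull A) (hδ : 0 < δ) (hH : IsStoppingTime brownianFiltration H) :
    IsStronglyProgressive brownianFiltration (thrYMod hA hδ H) := by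
  intro i
  letI : MeasurableSpace (Set.Iic i × (ℝ≥0 → ℝ)) := MeasurableSpace.prod Subtype.instMeasurableSpace (brownianFiltration i)
  have hf : ∀ n, StronglyMeasurable fun p : Set.Iic i × (ℝ≥0 → ℝ) ↦ thrLevelSum 6 hA hδ H n p.1 p.2 := fun n ↦
    isStronglyProgressive_thrLevelSum (κ := 6) (hA := hA) (hδ := hδ) hH n i
  have h := (StronglyMeasurable.limUnder (l := atTop) hf).const_mul ((Real.sqrt 6)⁻¹)
  exact h

/-- On a path along which the dichotomy holds up to and including the horizon, `Ỹ = Y`. [folklore] -/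
theorem thrYMod_eq_of_clusterwise (hA : IsStarHull A) (hδ : 0 < δ) {ω : ℝ≥0 → ℝ}
    (hclw : ∀ t : ℝ≥0, (t : WithTop ℝ≥0) ≤ H ω → ∀ a ∈ A, deltaCluster A δ a ⊆ closedHull (drvK 6 (brownianCPath ω)) t ∨
      Disjoint (deltaCluster A δ a) (closedHull (drvK 6 (brownianCPath ω)) t)) (t : ℝ≥0) :
    thrYMod hA hδ H t ω = (Real.sqrt 6)⁻¹ * stoppedProcess (fun t ω ↦ thrImageDriver (drvK 6 (brownianCPath ω)) A t) H t ω := by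
  rw [thrYMod_def, (tendsto_thrLevelSum (hA := hA) (hδ := hδ) (H := H) hclw t).limUnder_eq]

/-- Transport of a martingale clock structure along an a.e. equality of the processes. [folklore] -/
theorem _root_.Literature.Probability.Process.HasMartingaleClock.congr_ae {Ω : Type*} {m : MeasurableSpace Ω}
    {𝓕 : Filtration ℝ≥0 m} {P : Measure Ω} {Y Y' c : ℝ≥0 → Ω → ℝ} {C : ℝ} (h : HasMartingaleClock Y c 𝓕 P C)
    (hY : ∀ᵐ ω ∂P, ∀ t, Y t ω = Y' t ω) : HasMartingaleClock Y' c 𝓕 P C where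
  isAEMartingale := h.isAEMartingale.congr fun t ↦ hY.mono fun ω hω ↦ hω t
  isAEMartingale_sq_sub := h.isAEMartingale_sq_sub.congr fun t ↦ hY.mono fun ω hω ↦ by simp only [hω t]
  clock_zero := h.clock_zero
  clock_mono := h.clock_mono
  clock_sub_le := h.clock_sub_le
  abs_le := by filter_upwards [h.abs_le, hY] with ω h1 h2 t; rw [← h2 t]; exact h1 t

/-- **(1) The modification `Ỹ` carries the through-swallow clock** under the STRICT dichotomy on every path
and the dichotomy up to and including the horizon on almost every path. [cite: LawlerSchrammWerner2001, Thm. 2.2] -/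
theorem hasMartingaleClock_thrYMod {A : Set ℂ} (hA : IsStarHull A) {δ : ℝ} (hδ : 0 < δ)
    (H : (ℝ≥0 → ℝ) → WithTop ℝ≥0) (N : ℕ) (T₀ : ℝ≥0)
    (hH : IsStoppingTime brownianFiltration H)
    (hHcap : ∀ ω, H ω ≤ capTimeK 6 N ω) (hHT : ∀ ω, H ω ≤ (T₀ : WithTop ℝ≥0))
    (hclw_lt : ∀ ω (t : ℝ≥0), (t : WithTop ℝ≥0) < H ω → ∀ a ∈ A,
      deltaCluster A δ a ⊆ Loewner.closedHull (drvK 6 (brownianCPath ω)) t ∨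
        Disjoint (deltaCluster A δ a) (Loewner.closedHull (drvK 6 (brownianCPath ω)) t))
    (hclw_ae : ∀ᵐ ω ∂Process.preWienerMeasure, ∀ t : ℝ≥0, (t : WithTop ℝ≥0) ≤ H ω → ∀ a ∈ A,
      deltaCluster A δ a ⊆ Loewner.closedHull (drvK 6 (brownianCPath ω)) t ∨
        Disjoint (deltaCluster A δ a) (Loewner.closedHull (drvK 6 (brownianCPath ω)) t)) :
    ∃ C : ℝ, Process.HasMartingaleClock (thrYMod hA hδ H)
      (fun t ω ↦ Loewner.thrClock (drvK 6 (brownianCPath ω)) A (min (t : ℝ) (((H ω).untopD 0 : ℝ≥0) : ℝ)))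
      brownianFiltration Process.preWienerMeasure C := by
  haveI := isProbabilityMeasure_preWienerMeasure'
  have hHt : ∀ ω, H ω ≠ ⊤ := fun ω ↦ ne_top_of_le_ne_top WithTop.coe_ne_top (hHT ω)
  have h6 : (0 : ℝ) < Real.sqrt 6 := Real.sqrt_pos.2 (by norm_num)
  obtain ⟨R₁, hR₁⟩ := hA.isBoundedHull.isCompact.isBounded.subset_closedBall (0 : ℂ)
  set R : ℝ := max R₁ 1 with hR
  have hR0 : 0 < R := lt_max_of_lt_right one_pos
  have hAR : A ⊆ closedBall (0 : ℂ) R := hR₁.trans (closedBall_subset_closedBall (le_max_left _ _))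
  set K : ℝ := ((N : ℝ) + 1) + 1160 * (3 * ((N : ℝ) + 1) + 13 * Real.sqrt T₀ + R) with hK
  set Pw := (clusterFinset hA hδ).powerset with hPw
  set B₁ : ℝ := Pw.card * (2 * K) with hB₁
  set B₂ : ℝ := Pw.card * ((2 * K) ^ 2 + 6 * T₀ + 2 * (Pw.card * (2 * K)) * (2 * K)) with hB₂
  set U : ℝ≥0 → (ℝ≥0 → ℝ) → ℝ := stoppedProcess (fun t ω ↦ thrImageDriver (drvK 6 (brownianCPath ω)) A t) H with hUdef
  set c : ℝ≥0 → (ℝ≥0 → ℝ) → ℝ := fun t ω ↦ thrClock (drvK 6 (brownianCPath ω)) A (min (t : ℝ) (((H ω).untopD 0 : ℝ≥0) : ℝ)) with hcdef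
  have hc_eq : ∀ t ω, c t ω = thrClock (drvK 6 (brownianCPath ω)) A ((min (t : WithTop ℝ≥0) (H ω)).untopA : ℝ≥0) := fun t ω ↦ by
    rw [hcdef]; simp only; rw [min_untopD_eq (hHt ω)]
  -- on the good paths
  have hY_eq : ∀ᵐ ω ∂preWienerMeasure, ∀ t, thrYMod hA hδ H t ω = (Real.sqrt 6)⁻¹ * U t ω := by
    filter_upwards [hclw_ae] with ω hω t
    exact thrYMod_eq_of_clusterwise hA hδ hω t
  have hlimU : ∀ t, ∀ᵐ ω ∂preWienerMeasure, Tendsto (fun n ↦ (Real.sqrt 6)⁻¹ * thrLevelSum 6 hA hδ H n t ω) atTop (𝓝 (thrYMod hA hδ H t ω)) := by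
    intro t
    filter_upwards [hclw_ae] with ω hω
    rw [thrYMod_eq_of_clusterwise hA hδ hω t]
    exact (tendsto_thrLevelSum hω t).const_mul _
  have hsq : ((Real.sqrt 6)⁻¹) ^ 2 = (6 : ℝ)⁻¹ := by rw [inv_pow, Real.sq_sqrt (by norm_num)]
  have hlimB : ∀ t, ∀ᵐ ω ∂preWienerMeasure, Tendsto (fun n ↦ (6 : ℝ)⁻¹ * thrLevelBracket 6 hA hδ H n t ω) atTop
      (𝓝 (thrYMod hA hδ H t ω ^ 2 - c t ω)) := by
    intro t
    filter_upwards [hclw_ae] with ω hω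
    have h := (tendsto_thrLevelBracket (hA := hA) (hδ := hδ) (H := H) (hHt ω) hω t).const_mul ((6 : ℝ)⁻¹)
    rw [thrYMod_eq_of_clusterwise hA hδ hω t, hc_eq t ω]
    convert h using 2
    rw [mul_pow, hsq]; ring
  -- the bounds
  have hbU : ∀ n t ω, |(Real.sqrt 6)⁻¹ * thrLevelSum 6 hA hδ H n t ω| ≤ (Real.sqrt 6)⁻¹ * B₁ := fun n t ω ↦ by
    rw [abs_mul, abs_of_pos (inv_pos.2 h6)]
    exact mul_le_mul_of_nonneg_left (abs_thrLevelSum_le hHcap hHT hR0 hAR n t ω) (inv_pos.2 h6).le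
  have hbB : ∀ n t ω, |(6 : ℝ)⁻¹ * thrLevelBracket 6 hA hδ H n t ω| ≤ (6 : ℝ)⁻¹ * B₂ := fun n t ω ↦ by
    rw [abs_mul, abs_of_pos (by norm_num : (0 : ℝ) < 6⁻¹)]
    exact mul_le_mul_of_nonneg_left (abs_thrLevelBracket_le hHcap hHT hR0 hAR n t ω) (by norm_num)
  -- the a.e. martingales
  have hMk1 : ∀ n, IsAEMartingale (fun t ω ↦ (Real.sqrt 6)⁻¹ * thrLevelSum 6 hA hδ H n t ω) brownianFiltration preWienerMeasure :=
    fun n ↦ (isAEMartingale_thrLevelSum hH n).const_mul _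
  have hMk2 : ∀ n, IsAEMartingale (fun t ω ↦ (6 : ℝ)⁻¹ * thrLevelBracket 6 hA hδ H n t ω) brownianFiltration preWienerMeasure :=
    fun n ↦ (isAEMartingale_thrLevelBracket hH hHcap hHT hR0 hAR n).const_mul _
  have hM1 : IsAEMartingale (thrYMod hA hδ H) brownianFiltration preWienerMeasure := by
    refine IsAEMartingale.of_tendsto_ae hMk1 (fun t ↦ ?_) hlimU
    exact uniformIntegrable_of_abs_le (fun n ↦ ((hMk1 n).aestronglyMeasurable t).mono (brownianFiltration.le t))
      fun n ↦ ae_of_all _ fun ω ↦ hbU n t ω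
  have hM2 : IsAEMartingale (fun t ω ↦ thrYMod hA hδ H t ω ^ 2 - c t ω) brownianFiltration preWienerMeasure := by
    refine IsAEMartingale.of_tendsto_ae hMk2 (fun t ↦ ?_) hlimB
    exact uniformIntegrable_of_abs_le (fun n ↦ ((hMk2 n).aestronglyMeasurable t).mono (brownianFiltration.le t))
      fun n ↦ ae_of_all _ fun ω ↦ hbB n t ω
  have habs : ∀ᵐ ω ∂preWienerMeasure, ∀ t, |thrYMod hA hδ H t ω| ≤ (Real.sqrt 6)⁻¹ * B₁ := by
    filter_upwards [hclw_ae] with ω hω t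
    have hl : Tendsto (fun n ↦ (Real.sqrt 6)⁻¹ * thrLevelSum 6 hA hδ H n t ω) atTop (𝓝 (thrYMod hA hδ H t ω)) := by
      rw [thrYMod_eq_of_clusterwise hA hδ hω t]; exact (tendsto_thrLevelSum hω t).const_mul _
    exact le_of_tendsto ((continuous_abs.tendsto _).comp hl) (Eventually.of_forall fun n ↦ hbU n t ω)
  refine ⟨(Real.sqrt 6)⁻¹ * B₁, ?_⟩
  exact
    { isAEMartingale := hM1
      isAEMartingale_sq_sub := hM2
      clock_zero := fun ω ↦ by
        show thrClock (drvK 6 (brownianCPath ω)) A (min ((0 : ℝ≥0) : ℝ) (((H ω).untopD 0 : ℝ≥0) : ℝ)) = 0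
        rw [NNReal.coe_zero, min_eq_left (NNReal.coe_nonneg _), thrClock_zero]
      clock_mono := fun ω s t hst ↦ (thrClock_min_mono_of_lt (κ := 6) hA hδ (hHt ω) (hclw_lt ω) hst).1
      clock_sub_le := fun ω s t hst ↦ (thrClock_min_mono_of_lt (κ := 6) hA hδ (hHt ω) (hclw_lt ω) hst).2
      abs_le := habs }

/-- **(5) `Ỹ = Y` on almost every path (all times at once).** [folklore] -/
theorem ae_thrYMod_eq (hA : IsStarHull A) (hδ : 0 < δ)
    (hclw_ae : ∀ᵐ ω ∂Process.preWienerMeasure, ∀ t : ℝ≥0, (t : WithTop ℝ≥0) ≤ H ω → ∀ a ∈ A,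
      deltaCluster A δ a ⊆ Loewner.closedHull (drvK 6 (brownianCPath ω)) t ∨
        Disjoint (deltaCluster A δ a) (Loewner.closedHull (drvK 6 (brownianCPath ω)) t)) :
    ∀ᵐ ω ∂Process.preWienerMeasure, ∀ t : ℝ≥0, thrYMod hA hδ H t ω =
      (Real.sqrt 6)⁻¹ * stoppedProcess (fun t ω ↦ Loewner.thrImageDriver (drvK 6 (brownianCPath ω)) A t) H t ω := by
  filter_upwards [hclw_ae] with ω hω t
  exact thrYMod_eq_of_clusterwise hA hδ hω t

/-- **(4) `Ỹ` has continuous paths almost surely.** [folklore] -/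
theorem ae_continuous_thrYMod (hA : IsStarHull A) (hδ : 0 < δ) (hHt : ∀ ω, H ω ≠ ⊤)
    (hclw_ae : ∀ᵐ ω ∂Process.preWienerMeasure, ∀ t : ℝ≥0, (t : WithTop ℝ≥0) ≤ H ω → ∀ a ∈ A,
      deltaCluster A δ a ⊆ Loewner.closedHull (drvK 6 (brownianCPath ω)) t ∨
        Disjoint (deltaCluster A δ a) (Loewner.closedHull (drvK 6 (brownianCPath ω)) t)) :
    ∀ᵐ ω ∂Process.preWienerMeasure, Continuous fun t ↦ thrYMod hA hδ H t ω := by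
  filter_upwards [hclw_ae] with ω hω
  have heq : (fun t ↦ thrYMod hA hδ H t ω) =
      fun t ↦ (Real.sqrt 6)⁻¹ * stoppedProcess (fun t ω ↦ thrImageDriver (drvK 6 (brownianCPath ω)) A t) H t ω :=
    funext fun t ↦ thrYMod_eq_of_clusterwise hA hδ hω t
  rw [heq]
  exact continuous_const.mul (continuous_stoppedProcess_thrImageDriver (κ := 6) hA hδ (hHt ω) hω)

/-- **(3) The clock process is adapted** (every path, strict dichotomy). [folklore] -/
theorem adapted_thrClockProc_of_lt (hA : IsStarHull A) (hδ : 0 < δ) (hH : IsStoppingTime brownianFiltration H)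
    (hHt : ∀ ω, H ω ≠ ⊤)
    (hclw_lt : ∀ (ω : ℝ≥0 → ℝ) (t : ℝ≥0), (t : WithTop ℝ≥0) < H ω → ∀ a ∈ A,
      deltaCluster A δ a ⊆ Loewner.closedHull (drvK 6 (brownianCPath ω)) t ∨
        Disjoint (deltaCluster A δ a) (Loewner.closedHull (drvK 6 (brownianCPath ω)) t)) :
    Adapted brownianFiltration
      (fun t ω ↦ Loewner.thrClock (drvK 6 (brownianCPath ω)) A (min (t : ℝ) (((H ω).untopD 0 : ℝ≥0) : ℝ))) :=
  adapted_thrClock_min_of_lt (κ := 6) hA hδ hH hHt hclw_lt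

/-- **The integrability input of the packaging on every path**: `IntegrableOn (thrClockRate …) (Icc 0 ((H ω).untopD 0))`
under the strict dichotomy. [folklore] -/
theorem integrableOn_thrClockRate_untopD_of_lt (hA : IsStarHull A) (hδ : 0 < δ) {ω : ℝ≥0 → ℝ} (hHt : H ω ≠ ⊤)
    (hclw_lt : ∀ t : ℝ≥0, (t : WithTop ℝ≥0) < H ω → ∀ a ∈ A,
      deltaCluster A δ a ⊆ Loewner.closedHull (drvK κ (brownianCPath ω)) t ∨
        Disjoint (deltaCluster A δ a) (Loewner.closedHull (drvK κ (brownianCPath ω)) t)) :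
    IntegrableOn (thrClockRate (drvK κ (brownianCPath ω)) A) (Icc (0 : ℝ) (((H ω).untopD 0 : ℝ≥0) : ℝ)) := by
  obtain ⟨h, hh⟩ := WithTop.ne_top_iff_exists.1 hHt
  rw [← hh, WithTop.untopD_coe]
  exact integrableOn_thrClockRate_of_clusterwise_lt (κ := κ) hA hδ fun t ht ↦ hclw_lt t (by rw [← hh]; exact WithTop.coe_lt_coe.2 ht)

/-- **The raw process `Y` under the weakened hypotheses**: the martingale clock structure transported from `Ỹ`
along `Ỹ = Y` a.e. [cite: LawlerSchrammWerner2001, Thm. 2.2] -/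
theorem hasMartingaleClock_thrImageDriver_of_ae {A : Set ℂ} (hA : IsStarHull A) {δ : ℝ} (hδ : 0 < δ)
    (H : (ℝ≥0 → ℝ) → WithTop ℝ≥0) (N : ℕ) (T₀ : ℝ≥0)
    (hH : IsStoppingTime brownianFiltration H)
    (hHcap : ∀ ω, H ω ≤ capTimeK 6 N ω) (hHT : ∀ ω, H ω ≤ (T₀ : WithTop ℝ≥0))
    (hclw_lt : ∀ ω (t : ℝ≥0), (t : WithTop ℝ≥0) < H ω → ∀ a ∈ A,
      deltaCluster A δ a ⊆ Loewner.closedHull (drvK 6 (brownianCPath ω)) t ∨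
        Disjoint (deltaCluster A δ a) (Loewner.closedHull (drvK 6 (brownianCPath ω)) t))
    (hclw_ae : ∀ᵐ ω ∂Process.preWienerMeasure, ∀ t : ℝ≥0, (t : WithTop ℝ≥0) ≤ H ω → ∀ a ∈ A,
      deltaCluster A δ a ⊆ Loewner.closedHull (drvK 6 (brownianCPath ω)) t ∨
        Disjoint (deltaCluster A δ a) (Loewner.closedHull (drvK 6 (brownianCPath ω)) t)) :
    ∃ C : ℝ, Process.HasMartingaleClock
      (fun t ω ↦ (Real.sqrt 6)⁻¹ * stoppedProcess (fun t ω ↦ Loewner.thrImageDriver (drvK 6 (brownianCPath ω)) A t) H t ω)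
      (fun t ω ↦ Loewner.thrClock (drvK 6 (brownianCPath ω)) A (min (t : ℝ) (((H ω).untopD 0 : ℝ≥0) : ℝ)))
      brownianFiltration Process.preWienerMeasure C := by
  obtain ⟨C, hC⟩ := hasMartingaleClock_thrYMod hA hδ H N T₀ hH hHcap hHT hclw_lt hclw_ae
  exact ⟨C, hC.congr_ae (ae_thrYMod_eq hA hδ hclw_ae)⟩

end Modification

end Literature.Probability.RandomPlanarGeometry

end
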